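import Summits.QuantumFields.YangMills.Theorems.BalabanLadderIRTwistedSlabBoxAnchor
import HarnessLib

/-!
# T1's prefactor `C·L` is NECESSARY: no bound `C·e^{−ct}` uniform in the long extent `L` holds for the projected twisted slab of `SU(N)`
# (a format negative on the shape of `TwistedSlabAnchor`)

HELPER toward stub **T1** `TwistedSlabAnchor` of LINE `twisted-slab-continuity` (crux `IRcof`, stmt-QuantumFields-26930, census row 43;
LEAD prover ym-ir-line-tsc-p1 g6; `--supports` the crux, `--as helper`).  Theorems only.  K44 of the T1 programme: a NEGATIVE about the
stub's SHAPE (not about the stub).  T1 bounds the e₂-projected purity defect by `C·L·e^{−ct}` — exponentially small in the Euclidean time `t`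
with a prefactor LINEAR in the long extent `L`.  THE NUMBER (K31d `tendsto_projSlabDefect_tanh`: `lim_β projSlabDefect = 1 − ∏_{p,q} tanh²(tω_{p,q}∕2)`)
shows the prefactor cannot be dropped: at fixed `t` every factor is `≤ tanh²(tω_max∕2) < 1` with `ω_max = 2arsinh(√3)` the top of the lattice
dispersion, there are at least `L` factors, so the classical defect tends to `1` as `L → ∞` AT FIXED `t`; since the finite-`β` defect converges to
it, NO bound of the form `f(t)` with `f(t) → 0`, uniform in `L` and eventually in `β`, can hold.

* §1 `tanh_sq_mono` (`0 ≤ x ≤ y ⇒ tanh²x ≤ tanh²y`), `tanh_sq_lt_one'`, `three_cos_dispersion_bounds` (`0 ≤ Σ_{i<3}(2 − 2cos θ_i) ≤ 12`),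
  `ladderFreq_factor_le` (`λ ≤ 12 ⇒ tanh²(t·arsinh(√λ∕2)) ≤ tanh²(t·arsinh(√12∕2))` for `t ≥ 0`: every factor of THE NUMBER is below the top of the
  lattice dispersion), `prod_prod_le_pow_card` (a double product of factors in `[0,1]` is `≤ τ^{#β}` if one row is `≤ τ`),
  ★★ `one_sub_pow_le_classicalDefect` (abstract dispersion `λ : P → Q → (−∞,12]`: `1 − τ^{#Q} ≤ 1 − ∏_p∏_q tanh²(t·(2arsinh(√λ∕2))∕2)`);
* §2 ★★★ `not_twistedSlabAnchor_shape_of_tendsto_zero` — for `N ≥ 2`, `k` a unit, `n ≥ 1`, `(ω^k·1)^n = 1`, every `ℓ₀ = m+1` and EVERY `f : ℕ → ℝ`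
  with `f(t) → 0`: `¬ ∃ β₀, ∀ β ≥ β₀, ∀ m₂, ∀ t ≥ 1, projSlabDefect(fund; β, ω^k·1, n, ℓ₀, m₂+1, t) ≤ f t` — no `L`-independent majorant;
  ★★★ `not_twistedSlabAnchor_shape_uniform_prefactor` — in particular T1 with `C·e^{−ct}` in place of `C·L·e^{−ct}` is FALSE.

WHY (for the line): K36 shows `C·L·e^{−ct}` IS the tree-level shape (uniformly); this file shows the `L` cannot be removed — so any reshape of T1
must keep a prefactor growing at least like the number of longitudinal modes (g5's dead end «no single-time hypothesis is L-uniform», now a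
theorem), and a cluster expansion for M4 must produce the entropy factor `L` from polymers winding the time circle (memo §16.3 (m6)).
HONEST FRAMING: a negative about a WRONG shape, proved from the classical limit; it says nothing against T1 itself (whose shape is right);
T1 0∕1; IRcof ∕ IR 0∕1; the Yang–Mills mass gap (Clay) is NOT proved; R4 = `BalabanLadder.UV` only.
References: G. 't Hooft, Nucl. Phys. B 153 (1979) §5; M. García Pérez, A. González-Arroyo, M. Okawa, IJMPA 29 (2014) 1445001 §3.
-/

set_option autoImplicit false

noncomputable section

open Filter Topology Finset
open scoped BigOperators
open Literature.MathematicalPhysics.QuantumFieldTheory Literature.MathematicalPhysics.QuantumLattice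
open Literature.Analysis.Matrix.TwistedCycleLaplacian
open Literature.Combinatorics.SimpleGraph (cycleAngle)

namespace Summit.QuantumFields.YangMills.Cruxes.IRcof.TwistedSlab

/-! ## §1 Elementary bounds on the factors of THE NUMBER -/

/-- `tanh²` is non-decreasing on `[0, ∞)`: `0 ≤ x ≤ y ⇒ tanh² x ≤ tanh² y` (via `1 − tanh² = 1∕cosh²` and monotonicity of `cosh`). [folklore] -/
theorem tanh_sq_mono {x y : ℝ} (hx : 0 ≤ x) (hxy : x ≤ y) : Real.tanh x ^ 2 ≤ Real.tanh y ^ 2 := by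
  have ex := one_sub_tanh_sq_eq_inv_cosh_sq x
  have ey := one_sub_tanh_sq_eq_inv_cosh_sq y
  have hc : Real.cosh x ≤ Real.cosh y :=
    Real.cosh_le_cosh.2 (by rw [abs_of_nonneg hx, abs_of_nonneg (hx.trans hxy)]; exact hxy)
  have hcx := Real.cosh_pos x
  have hinv : (Real.cosh y ^ 2)⁻¹ ≤ (Real.cosh x ^ 2)⁻¹ :=
    inv_anti₀ (by positivity) (pow_le_pow_left₀ hcx.le hc 2)
  linarith

/-- `tanh² y < 1`. [folklore] -/
theorem tanh_sq_lt_one' (y : ℝ) : Real.tanh y ^ 2 < 1 := by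
  have h1 := Real.tanh_lt_one y
  have h2 := Real.neg_one_lt_tanh y
  nlinarith

/-- `0 ≤ tanh² y ≤ 1`. [folklore] -/
theorem tanh_sq_le_one' (y : ℝ) : Real.tanh y ^ 2 ≤ 1 := (tanh_sq_lt_one' y).le

/-- The three-plane lattice dispersion lies in `[0, 12]`: `0 ≤ Σ_{i<3}(2 − 2cos θ_i) ≤ 12` (associated as in K31d's THE NUMBER). [folklore] -/
theorem three_cos_dispersion_bounds (a b c : ℝ) :
    0 ≤ (2 - 2 * Real.cos a) + ((2 - 2 * Real.cos b) + (2 - 2 * Real.cos c)) ∧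
      (2 - 2 * Real.cos a) + ((2 - 2 * Real.cos b) + (2 - 2 * Real.cos c)) ≤ 12 := by
  have ha := Real.neg_one_le_cos a
  have hb := Real.neg_one_le_cos b
  have hc := Real.neg_one_le_cos c
  have ha' := Real.cos_le_one a
  have hb' := Real.cos_le_one b
  have hc' := Real.cos_le_one c
  constructor <;> linarith

/-- **Every factor of THE NUMBER is below the top of the dispersion**: for `t ≥ 0` and `0 ≤ λ ≤ 12`,
`tanh²(t·(2arsinh(√λ∕2))∕2) ≤ tanh²(t·(2arsinh(√12∕2))∕2)`. [cite: GarciaperezGonzalezarroyoOkawa2014, §3] -/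
theorem ladderFreq_factor_le {t : ℝ} (ht : 0 ≤ t) {lam : ℝ} (h12 : lam ≤ 12) :
    Real.tanh (t * (2 * Real.arsinh (Real.sqrt lam / 2)) / 2) ^ 2 ≤ Real.tanh (t * (2 * Real.arsinh (Real.sqrt 12 / 2)) / 2) ^ 2 := by
  have hsqrt : Real.sqrt lam ≤ Real.sqrt 12 := Real.sqrt_le_sqrt h12
  have hars : Real.arsinh (Real.sqrt lam / 2) ≤ Real.arsinh (Real.sqrt 12 / 2) := Real.arsinh_le_arsinh.2 (by linarith)
  have hars0 : 0 ≤ Real.arsinh (Real.sqrt lam / 2) := Real.arsinh_nonneg_iff.2 (by positivity)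
  refine tanh_sq_mono (by positivity) ?_
  have := mul_le_mul_of_nonneg_left hars ht
  linarith

/-- A double product of factors in `[0, 1]` one of whose rows is bounded by `τ ≥ 0` is at most `τ^{#β}`. [folklore] -/
theorem prod_prod_le_pow_card {α β : Type*} [Fintype α] [Fintype β] [DecidableEq α] (F : α → β → ℝ)
    (h0 : ∀ a b, 0 ≤ F a b) (h1 : ∀ a b, F a b ≤ 1) (a₀ : α) {τ : ℝ} (hτ : ∀ b, F a₀ b ≤ τ) :
    ∏ a, ∏ b, F a b ≤ τ ^ Fintype.card β := by
  have hrow : ∀ a, 0 ≤ ∏ b, F a b := fun a => Finset.prod_nonneg fun b _ => h0 a b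
  have hrow1 : ∀ a, ∏ b, F a b ≤ 1 := fun a => Finset.prod_le_one (fun b _ => h0 a b) fun b _ => h1 a b
  have hrest : ∏ a ∈ Finset.univ.erase a₀, ∏ b, F a b ≤ 1 :=
    Finset.prod_le_one (fun a _ => hrow a) fun a _ => hrow1 a
  calc ∏ a, ∏ b, F a b = (∏ b, F a₀ b) * ∏ a ∈ Finset.univ.erase a₀, ∏ b, F a b :=
        (Finset.mul_prod_erase Finset.univ (fun a => ∏ b, F a b) (Finset.mem_univ a₀)).symm
    _ ≤ ∏ b, F a₀ b := mul_le_of_le_one_right (hrow a₀) hrest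
    _ ≤ ∏ _b : β, τ := Finset.prod_le_prod (fun b _ => h0 a₀ b) fun b _ => hτ b
    _ = τ ^ Fintype.card β := by rw [Finset.prod_const, Finset.card_univ]

/-- ★★ **THE NUMBER is large on long boxes at fixed time**: for a dispersion `λ : P → Q → (−∞,12]`, `t ≥ 0` and any row `p₀`,
`1 − τ^{#Q} ≤ 1 − ∏_p ∏_q tanh²(t·(2arsinh(√λ_{p,q}∕2))∕2)` with `τ = tanh²(t·arsinh(√12∕2)·…)` the top factor. [cite: GarciaperezGonzalezarroyoOkawa2014, §3] -/
theorem one_sub_pow_le_classicalDefect {P Q : Type*} [Fintype P] [Fintype Q] [DecidableEq P] {t : ℝ} (ht : 0 ≤ t)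
    (lam : P → Q → ℝ) (h12 : ∀ p q, lam p q ≤ 12) (p₀ : P) {τ : ℝ}
    (hτ : τ = Real.tanh (t * (2 * Real.arsinh (Real.sqrt 12 / 2)) / 2) ^ 2) :
    1 - τ ^ Fintype.card Q ≤ 1 - ∏ p, ∏ q, Real.tanh (t * (2 * Real.arsinh (Real.sqrt (lam p q) / 2)) / 2) ^ 2 := by
  have h := prod_prod_le_pow_card (fun p q => Real.tanh (t * (2 * Real.arsinh (Real.sqrt (lam p q) / 2)) / 2) ^ 2)
    (fun p q => sq_nonneg _) (fun p q => tanh_sq_le_one' _) p₀ (τ := τ)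
    (fun q => by rw [hτ]; exact ladderFreq_factor_le ht (h12 p₀ q))
  linarith

/-! ## §2 No `L`-uniform prefactor -/

variable {N : ℕ} [NeZero N] {k : ZMod N}

/-- ★★★ **NO `L`-INDEPENDENT MAJORANT TENDING TO ZERO.**  For `N ≥ 2`, `k` a unit (`z = ω^k·1`), `n ≥ 1` with `z^n = 1`, and every transverse
size `ℓ₀ = m + 1`: there is NO function `f` with `f(t) → 0` such that `projSlabDefect(fund; β, z, n, ℓ₀, L, t) ≤ f(t)` for all `β ≥ β₀`, all
`L = m₂ + 1` and all `t ≥ 1`.  (At fixed `t` the classical defect `1 − ∏ tanh²` tends to `1` along `L → ∞` — at least `L` factors `≤ tanh²(tω_max∕2) < 1`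
— and the finite-`β` defect converges to it, K31d.) [cite: tHooft1979Flux, §5 (5.1)–(5.4)] [cite: GarciaperezGonzalezarroyoOkawa2014, §3] -/
theorem not_twistedSlabAnchor_shape_of_tendsto_zero (hN : 2 ≤ N) (hk : IsUnit k) {n : ℕ} (hn : 0 < n)
    (hzn : (suCenter N k : Matrix.specialUnitaryGroup (Fin N) ℂ) ^ n = 1) (m : ℕ) {f : ℕ → ℝ}
    (hf : Tendsto f atTop (𝓝 0)) :
    ¬ ∃ β₀ : ℝ, ∀ β : ℝ, β₀ ≤ β → ∀ m₂ t : ℕ, 1 ≤ t →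
      projSlabDefect (fundamentalRep (Fin N)) β (suCenter N k : Matrix.specialUnitaryGroup (Fin N) ℂ) n (m + 1) (m₂ + 1) t ≤ f t := by
  rintro ⟨β₀, hbound⟩
  -- a twist-eating pair (the input of THE NUMBER)
  obtain ⟨⟨A', B', hAB'⟩, -, -⟩ := hasIsolatingTwist_suCenter (N := N) hk
  -- a time `t = m₃ + 1` with `f t < 1/4`
  obtain ⟨m₃, hT⟩ := (hf.eventually (gt_mem_nhds (show (0 : ℝ) < 1 / 4 by norm_num))).exists_forall_of_atTop
  have hft : f (m₃ + 1) < 1 / 4 := hT (m₃ + 1) (Nat.le_succ _)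
  -- the uniform factor bound `τ < 1` at that time and a length with `τ^{m₂+1} < 1/4`
  obtain ⟨τ, hτ⟩ : ∃ τ : ℝ, τ = Real.tanh (((m₃ + 1 : ℕ) : ℝ) * (2 * Real.arsinh (Real.sqrt 12 / 2)) / 2) ^ 2 := ⟨_, rfl⟩
  have hτ0 : 0 ≤ τ := by rw [hτ]; exact sq_nonneg _
  have hτ1 : τ < 1 := by rw [hτ]; exact tanh_sq_lt_one' _
  obtain ⟨m₂, hm₂⟩ := exists_pow_lt_of_lt_one (show (0 : ℝ) < 1 / 4 by norm_num) hτ1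
  have hcard : m₂ ≤ (m + 1) * ((m + 1) * (m₂ + 1)) := by
    have h1 : m₂ + 1 ≤ (m + 1) * (m₂ + 1) := Nat.le_mul_of_pos_left _ (by positivity)
    have h2 : (m + 1) * (m₂ + 1) ≤ (m + 1) * ((m + 1) * (m₂ + 1)) := Nat.le_mul_of_pos_left _ (by positivity)
    omega
  have hpow : τ ^ ((m + 1) * ((m + 1) * (m₂ + 1))) ≤ τ ^ m₂ := pow_le_pow_of_le_one hτ0 hτ1.le hcard
  -- THE NUMBER at `(m, m₂, m₃)` and its lower bound `≥ 1 − τ^{m₂}` > 3/4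
  have hlim := tendsto_projSlabDefect_tanh (m := m) (m₂ := m₂) (m₃ := m₃) hN hk hn hzn hAB'
  have hp₀ : ((0 : Fin N), (⟨1, by omega⟩ : Fin N)) ≠ (0, 0) := by
    intro h
    have h2 : (((⟨1, by omega⟩ : Fin N) : Fin N) : ℕ) = ((0 : Fin N) : ℕ) := by rw [(Prod.mk.inj h).2]
    simp at h2
  obtain ⟨V, hlimV, hV⟩ : ∃ V : ℝ, Tendsto (fun β : ℝ => projSlabDefect (fundamentalRep (Fin N)) β
      (suCenter N k : Matrix.specialUnitaryGroup (Fin N) ℂ) n (m + 1) (m₂ + 1) (m₃ + 1)) atTop (𝓝 V) ∧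
      1 - τ ^ ((m + 1) * ((m + 1) * (m₂ + 1))) ≤ V := by
    refine ⟨_, hlim, ?_⟩
    simpa only [Fintype.card_prod, Fintype.card_fin] using
      one_sub_pow_le_classicalDefect (P := {p : Fin N × Fin N // p ≠ (0, 0)}) (Q := Fin (m + 1) × Fin (m + 1) × Fin (m₂ + 1))
        (t := ((m₃ + 1 : ℕ) : ℝ)) (Nat.cast_nonneg _)
        (fun p q => (2 - 2 * Real.cos (-(2 * Real.pi * (k.val : ℝ) / N) * (p.1.2 : ℕ) / (m + 1 : ℕ) + cycleAngle (m + 1) q.1)) +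
          ((2 - 2 * Real.cos ((2 * Real.pi * (k.val : ℝ) / N) * (p.1.1 : ℕ) / (m + 1 : ℕ) + cycleAngle (m + 1) q.2.1)) +
            (2 - 2 * Real.cos (0 + cycleAngle (m₂ + 1) q.2.2))))
        (fun p q => (three_cos_dispersion_bounds _ _ _).2) ⟨_, hp₀⟩ hτ
  have hgt : (1 : ℝ) / 2 < V := by linarith
  have hev := (hlimV.eventually (Ioi_mem_nhds hgt)).and (eventually_ge_atTop β₀)
  obtain ⟨β, hβdef, hββ₀⟩ := hev.exists
  have hle := hbound β hββ₀ m₂ (m₃ + 1) (by omega)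
  have : (1 : ℝ) / 2 < f (m₃ + 1) := lt_of_lt_of_le hβdef (by exact_mod_cast hle)
  linarith

/-- ★★★ **T1 WITHOUT THE FACTOR `L` IS FALSE**: for `N ≥ 2`, `k` a unit, `n ≥ 1`, `(ω^k·1)^n = 1` and every `ℓ₀ = m+1` there are NO `β₀, c > 0, C` with
`projSlabDefect(fund; β, ω^k·1, n, ℓ₀, m₂+1, t) ≤ C·e^{−ct}` for all `β ≥ β₀`, all `m₂` and all `t ≥ 1`.  (T1's `C·L·e^{−ct}` is the right shape: K36 shows it
holds at tree level uniformly.) [cite: tHooft1979Flux, §5 (5.1)–(5.4)] [cite: GarciaperezGonzalezarroyoOkawa2014, §3] -/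
theorem not_twistedSlabAnchor_shape_uniform_prefactor (hN : 2 ≤ N) (hk : IsUnit k) {n : ℕ} (hn : 0 < n)
    (hzn : (suCenter N k : Matrix.specialUnitaryGroup (Fin N) ℂ) ^ n = 1) (m : ℕ) :
    ¬ ∃ β₀ c C : ℝ, 0 < c ∧ ∀ β : ℝ, β₀ ≤ β → ∀ m₂ t : ℕ, 1 ≤ t →
      projSlabDefect (fundamentalRep (Fin N)) β (suCenter N k : Matrix.specialUnitaryGroup (Fin N) ℂ) n (m + 1) (m₂ + 1) t ≤
        C * Real.exp (-(c * (t : ℝ))) := by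
  rintro ⟨β₀, c, C, hc, h⟩
  have hf : Tendsto (fun t : ℕ => C * Real.exp (-(c * (t : ℝ)))) atTop (𝓝 0) := by
    have h1 : Tendsto (fun t : ℕ => c * (t : ℝ)) atTop atTop :=
      (tendsto_natCast_atTop_atTop).const_mul_atTop hc
    have h2 : Tendsto (fun t : ℕ => Real.exp (-(c * (t : ℝ)))) atTop (𝓝 0) :=
      Real.tendsto_exp_neg_atTop_nhds_zero.comp h1
    simpa using h2.const_mul C
  exact not_twistedSlabAnchor_shape_of_tendsto_zero hN hk hn hzn m hf ⟨β₀, fun β hβ m₂ t ht => h β hβ m₂ t ht⟩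

end Summit.QuantumFields.YangMills.Cruxes.IRcof.TwistedSlab

end
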